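import Mathlib
import Summits.NavierStokesRegularity.NavierStokesRegularity.Theorems.PlaneEnergyCeilingPlanarEnergyAPrioriWeightedIdentity
import Summits.NavierStokesRegularity.NavierStokesRegularity.Theorems.PlaneEnergyCeilingPlanarEnergyAPrioriFluxLedgerLH

/-!
# Route PlaneEnergyCeiling · crux `PlanarEnergyAPriori` — the signed flux ledger, unconditional

Helper file for the crux item stmt-NavierStokesRegularity-16855 (`PlanarEnergyAPriori`, route
`PlaneEnergyCeiling`), landed `--supports` that item. The flux ledger of
`Theorems/…FluxLedger.lean` / `…FluxLedgerLH.lean` was stated conditional on the weighted energy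
identity (hypothesis `hWI`); that identity is now landed (`weightedEnergyIdentity`,
`Theorems/…WeightedIdentity.lean`), so the ledger holds outright:

* `fluxLedger` — along a classical solution of unforced Navier–Stokes on `ℝ³ × [0,t]` with
  order-(3,2) decay in the energy class (`∫|u(s)|² ≤ 2E₀`, `ν∫₀ᵗ∫Σⱼ‖∂ⱼu‖² ≤ E₀`), for every `C²`
  weight `0 ≤ g ≤ 1` of the height with `|g'| ≤ K₁`, `|g''| ≤ K₂` and all `0 ≤ s₁ ≤ s₂ ≤ t`:
  `|∫_{(s₁,s₂)}∫ g'(x₂)(|u|²/2 + (p − π₀(s)))u₂ dx ds| ≤ E₀ (2 + νK₂(s₂ − s₁))`;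
* `fluxLedger_alongLH` — the same along the crux's own class (classical on `[0,T)`, Leray–Hopf
  from `u 0`, order-(3,2) decay on a closed slab `[0,t]`, `t < T`), with
  `E₀ = kineticEnergy (u 0) = ½‖u(0)‖₂²`.

This is the route's FLUX LEDGER `|∫F_ℓ dt| ≤ E₀(2 + cνΔt/ℓ²)` (TWO-LAYER PLAN: the first child of
the open stub `stub_fluxConvergenceBudget`): the SIGNED time integrals of the smoothed Bernoulli
flux through every coordinate plane are bounded a priori by the energy. Folklore
(Caffarelli–Kohn–Nirenberg 1982 §2).
-/

noncomputable section

-- single-conjunct summit: `Summit.<Summit>.<Problem>` repeats the name by the D-0017 layout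
set_option linter.dupNamespace false

namespace Summit.NavierStokesRegularity.NavierStokesRegularity.Theorems.PlanarEnergyAPriori

open MeasureTheory Set Filter Topology Function WithLp
open scoped ENNReal RealInnerProductSpace Laplacian
open Literature.Analysis.FluidPDE

variable {ν t T : ℝ} {u : ℝ → EuclideanSpace ℝ (Fin 3) → EuclideanSpace ℝ (Fin 3)} {p : ℝ → EuclideanSpace ℝ (Fin 3) → ℝ}

/-- **THE SIGNED FLUX LEDGER.** Let `(u,p)` be a classical solution of unforced Navier–Stokes on
`ℝ³ × [0,t]` (`ν > 0`, `t > 0`) with order-(3,2) decay on `[0,t]` (pressure normalised by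
`π₀(s)`), energies `∫|u(s)|² ≤ 2E₀` and dissipation `ν∫₀ᵗ∫Σⱼ‖∂ⱼu‖² ≤ E₀`. Then for every `C²`
weight `g` of the height with `0 ≤ g ≤ 1`, `|g'| ≤ K₁`, `|g''| ≤ K₂` and all `0 ≤ s₁ ≤ s₂ ≤ t`:
`|∫_{(s₁,s₂)} ∫ g'(x₂)(|u|²/2 + (p − π₀(s)))u₂ dx ds| ≤ E₀ (2 + ν K₂ (s₂ − s₁))`. [folklore] -/
theorem fluxLedger (hν : 0 < ν) (ht : 0 < t) (hcl : IsClassicalNSSolutionOn (Icc 0 t) ν 0 u p)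
    {C : ℝ} {π₀ : ℝ → ℝ}
    (h0 : ∀ s ∈ Icc 0 t, ∀ x, ‖u s x‖ ≤ C * (1 + ‖x‖) ^ (-(3 : ℝ)))
    (h1 : ∀ s ∈ Icc 0 t, ∀ x, ‖fderiv ℝ (u s) x‖ ≤ C * (1 + ‖x‖) ^ (-(3 : ℝ)))
    (h2 : ∀ s ∈ Icc 0 t, ∀ x, ‖iteratedFDeriv ℝ 2 (u s) x‖ ≤ C * (1 + ‖x‖) ^ (-(3 : ℝ)))
    (k0 : ∀ s ∈ Icc 0 t, ∀ x, |p s x - π₀ s| ≤ C * (1 + ‖x‖) ^ (-(2 : ℝ)))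
    (k1 : ∀ s ∈ Icc 0 t, ∀ x, ‖gradient (p s) x‖ ≤ C * (1 + ‖x‖) ^ (-(2 : ℝ)))
    {E₀ : ℝ} (hE : ∀ s ∈ Icc 0 t, ∫ x, ‖u s x‖ ^ 2 ≤ 2 * E₀)
    (hDiss : ν * ∫ s in Ioo 0 t, ∫ x, ∑ j : Fin 3, ‖fderiv ℝ (u s) x (EuclideanSpace.single j 1)‖ ^ 2 ≤ E₀)
    {g : ℝ → ℝ} (hg : ContDiff ℝ 2 g) {K₁ K₂ : ℝ} (hg01 : ∀ z, 0 ≤ g z ∧ g z ≤ 1)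
    (hK₁ : ∀ z, |deriv g z| ≤ K₁) (hK₂ : ∀ z, |deriv (deriv g) z| ≤ K₂)
    {s₁ s₂ : ℝ} (hs₁ : 0 ≤ s₁) (hs : s₁ ≤ s₂) (hs₂ : s₂ ≤ t) :
    |∫ s in Ioo s₁ s₂, ∫ x, deriv g (x 2) * ((‖u s x‖ ^ 2 / 2 + (p s x - π₀ s)) * u s x 2)| ≤
      E₀ * (2 + ν * K₂ * (s₂ - s₁)) :=
  fluxLedger_of_weightedEnergyIdentity weightedEnergyIdentity hν ht hcl h0 h1 h2 k0 k1 hE hDiss hg hg01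
    hK₁ hK₂ hs₁ hs hs₂

/-- **The flux ledger along the crux's class.** Along a classical solution of unforced
Navier–Stokes on `ℝ³ × [0,T)` (`ν > 0`) that is Leray–Hopf from `u 0`, carrying order-(3,2) decay
on a closed slab `[0,t]`, `0 < t < T`: for every `C²` weight `0 ≤ g ≤ 1` of the height with
`|g'| ≤ K₁`, `|g''| ≤ K₂` and all `0 ≤ s₁ ≤ s₂ ≤ t`,
`|∫_{(s₁,s₂)}∫ g'(x₂)(|u|²/2 + (p − π₀(s)))u₂| ≤ E₀ (2 + νK₂(s₂ − s₁))`, `E₀ = kineticEnergy (u 0)`.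
[folklore] -/
theorem fluxLedger_alongLH (hν : 0 < ν) (hT : 0 < T) (hns : IsClassicalNSSolutionOn (Ico 0 T) ν 0 u p)
    (hlh : IsLerayHopfOn T ν 0 (u 0) u) (ht0 : 0 < t) (htT : t < T)
    {C : ℝ} {π₀ : ℝ → ℝ}
    (h0 : ∀ s ∈ Icc 0 t, ∀ x, ‖u s x‖ ≤ C * (1 + ‖x‖) ^ (-(3 : ℝ)))
    (h1 : ∀ s ∈ Icc 0 t, ∀ x, ‖fderiv ℝ (u s) x‖ ≤ C * (1 + ‖x‖) ^ (-(3 : ℝ)))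
    (h2 : ∀ s ∈ Icc 0 t, ∀ x, ‖iteratedFDeriv ℝ 2 (u s) x‖ ≤ C * (1 + ‖x‖) ^ (-(3 : ℝ)))
    (k0 : ∀ s ∈ Icc 0 t, ∀ x, |p s x - π₀ s| ≤ C * (1 + ‖x‖) ^ (-(2 : ℝ)))
    (k1 : ∀ s ∈ Icc 0 t, ∀ x, ‖gradient (p s) x‖ ≤ C * (1 + ‖x‖) ^ (-(2 : ℝ)))
    {g : ℝ → ℝ} (hg : ContDiff ℝ 2 g) {K₁ K₂ : ℝ} (hg01 : ∀ z, 0 ≤ g z ∧ g z ≤ 1)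
    (hK₁ : ∀ z, |deriv g z| ≤ K₁) (hK₂ : ∀ z, |deriv (deriv g) z| ≤ K₂)
    {s₁ s₂ : ℝ} (hs₁ : 0 ≤ s₁) (hs : s₁ ≤ s₂) (hs₂ : s₂ ≤ t) :
    |∫ s in Ioo s₁ s₂, ∫ x, deriv g (x 2) * ((‖u s x‖ ^ 2 / 2 + (p s x - π₀ s)) * u s x 2)| ≤
      VectorCalculus.kineticEnergy (u 0) * (2 + ν * K₂ * (s₂ - s₁)) :=
  fluxLedger_alongLH_of_weightedEnergyIdentity weightedEnergyIdentity hν hT hns hlh ht0 htT h0 h1 h2 k0 k1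
    hg hg01 hK₁ hK₂ hs₁ hs hs₂

/-- **The signed flux ledger, registered closed form** (sub-goal `fluxLedger_closedForm` of
stmt-NavierStokesRegularity-16855; unconditional). [folklore] -/
theorem fluxLedger_closedForm : ∀ (ν t : ℝ), 0 < ν → 0 < t → ∀ (u : ℝ → EuclideanSpace ℝ (Fin 3) → EuclideanSpace ℝ (Fin 3)) (p : ℝ → EuclideanSpace ℝ (Fin 3) → ℝ), Literature.Analysis.FluidPDE.IsClassicalNSSolutionOn (Set.Icc 0 t) ν 0 u p → ∀ (C : ℝ) (π₀ : ℝ → ℝ), (∀ s ∈ Set.Icc 0 t, ∀ x, ‖u s x‖ ≤ C * (1 + ‖x‖) ^ (-(3 : ℝ))) → (∀ s ∈ Set.Icc 0 t, ∀ x, ‖fderiv ℝ (u s) x‖ ≤ C * (1 + ‖x‖) ^ (-(3 : ℝ))) → (∀ s ∈ Set.Icc 0 t, ∀ x, ‖iteratedFDeriv ℝ 2 (u s) x‖ ≤ C * (1 + ‖x‖) ^ (-(3 : ℝ))) → (∀ s ∈ Set.Icc 0 t, ∀ x, |p s x - π₀ s| ≤ C * (1 + ‖x‖) ^ (-(2 :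 ℝ))) → (∀ s ∈ Set.Icc 0 t, ∀ x, ‖gradient (p s) x‖ ≤ C * (1 + ‖x‖) ^ (-(2 : ℝ))) → ∀ (E₀ : ℝ), (∀ s ∈ Set.Icc 0 t, ∫ x, ‖u s x‖ ^ 2 ≤ 2 * E₀) → ν * (∫ s in Set.Ioo 0 t, ∫ x, ∑ j : Fin 3, ‖fderiv ℝ (u s) x (EuclideanSpace.single j 1)‖ ^ 2) ≤ E₀ → ∀ (g : ℝ → ℝ) (K₁ K₂ : ℝ), ContDiff ℝ 2 g → (∀ z, 0 ≤ g z ∧ g z ≤ 1) → (∀ z, |deriv g z| ≤ K₁) → (∀ z, |deriv (deriv g) z| ≤ K₂) → ∀ (s₁ s₂ : ℝ), 0 ≤ s₁ → s₁ ≤ s₂ → s₂ ≤ t → |∫ s in Set.Ioo s₁ s₂, ∫ x, deriv g (x 2) * ((‖u s x‖ ^ 2 / 2 + (p s x - π₀ s)) * u s x 2)| ≤ E₀ * (2 + ν * K₂ * (s₂ - s₁)) :=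
  fun _ _ hν ht _ _ hcl _ _ h0 h1 h2 k0 k1 _ hE hDiss _ _ _ hg hg01 hK₁ hK₂ _ _ hs₁ hs hs₂ =>
    fluxLedger hν ht hcl h0 h1 h2 k0 k1 hE hDiss hg hg01 hK₁ hK₂ hs₁ hs hs₂

end Summit.NavierStokesRegularity.NavierStokesRegularity.Theorems.PlanarEnergyAPriori

end
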